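import Literature.Computability.Cryptography.PeriodFindingInputFamily
import Literature.Computability.Cryptography.PeriodFindingUniform
import HarnessLib

/-!
# Period finding by eigenvalue estimation of shifts — the input-reading family is uniform

Topic `Computability/Cryptography`; continues `PeriodFindingInputFamily.lean`. The description of
the input-reading quantum core `familyI` differs from that of `family` (`PeriodFindingDesc/Prog/
Uniform.lean`) only in the oracle gates, whose wire lists are prefixed by the input wires
`0, …, n − 1`: the compute and uncompute words are literally the same (the transported operations
are placed on the same wires, `aoOfRt_mapI_cl`). We write the new abstract gate list (`aoQueryI`,
`aoBlockI`, `aoCircI`, `sigmaEncode_familyI`), its closed form (`aoQueryNI`, `queriesNI`, `aoCircNI`,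
`aoCircI_eq`) and its computation in the typed polynomial-time algebra (`queryI_fp`, `circNI_fp`,
`descI_fp`), whence **`familyI_isUniform`** by `QCircuitFamily.isUniform_iff_descFn_mem_FP`
(Arora–Barak 2009, §6.2; Bernstein–Vazirani 1997, §8). Theorem-and-definition file, no named facts.

## References

* S. Arora, B. Barak, *Computational Complexity: A Modern Approach*, CUP 2009, §6.2 [AroraBarak2009].
* E. Bernstein, U. Vazirani, SIAM J. Comput. 26 (1997), §8 [BernsteinVazirani1997].
* S. Hallgren, J. ACM 54 (2007), Art. 4, §4 [Hallgren2007].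
-/

noncomputable section

namespace Literature.Computability.Cryptography

namespace PeriodFinding

open QuantumComplexity QuantumComplexity.RazTalMachine QuantumComplexity.RevSim QuantumComplexity.OSim
  QuantumComplexity.RevDesc QuantumComplexity.AJLCore Complexity Complexity.CodeFP _root_.Computability
  Polynomial Finset Function Kitaev1995
open QuantumComplexity.YaoSim (codeFP_T_un codeFP_T_nat codeFP_unMulConst)

/-! ### The abstract gate list -/

section Desc

variable (S : BSpec) (n : ℕ)

/-- The abstract gate of query `(u, j)`: the input wires, the prefix, `X_u`, the answer wire. [folklore] -/
def aoQueryI (a : Σ u : Fin S.nU, Fin (S.L u)) : AO :=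
  (true, n + (qWires S a).length, (List.range n ++ (qWires S a).map (natAddr S n)) ++ [natAddr S n (qTgt S a)])

/-- **The abstract gates of the compiled input-reading block.** [folklore] -/
def aoBlockI : List AO :=
  (wOpsNat S n).flatMap aoCl ++ (qIdx S).map (aoQueryI S n) ++ (wOpsNat S n).reverse.flatMap aoCl

/-- **The abstract gates of the sandwich circuit around the input-reading block.** [folklore] -/
def aoCircI (σ : Fin (k₁ S) → Bool) : List AO :=
  aoHad n (k₁ S + k₂ S) ++ aoBlockI S n ++ aoPhase n (k₁ S + k₂ S) (σNat S σ) ++ aoHad n (k₁ S)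

variable {S n}

/-- The placement of the block wires factors through the original placement. [folklore] -/
theorem finAddrI_comp_inr : finAddrI S n ∘ Sum.inr = finAddr S n := rfl

/-- Transported classical operations are placed as before. [folklore] -/
theorem aoOfRt_mapI_cl (op : ClOp (BW S)) :
    aoOfRt (((RtOp.cl op : RtOp (BW S)).map Sum.inr).map (finAddrI S n)) = aoCl (op.map (natAddr S n)) := by
  rw [RtOp.map_map, finAddrI_comp_inr, aoOfRt_map_finAddr]

/-- The abstract gates of the transported compute part. [folklore] -/
theorem flatMap_aoOfRt_wOpsI :
    (wOpsI S n).flatMap (fun op => aoOfRt (op.map (finAddrI S n))) = (wOpsNat S n).flatMap aoCl := by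
  rw [wOpsI, wOpsNat, List.flatMap_map, List.flatMap_map, List.flatMap_map]
  exact List.flatMap_congr fun op _ => aoOfRt_mapI_cl (S := S) (n := n) op

/-- The abstract gates of the transported uncompute part. [folklore] -/
theorem flatMap_aoOfRt_wOpsRevI :
    (wOpsRevI S n).flatMap (fun op => aoOfRt (op.map (finAddrI S n))) = (wOpsNat S n).reverse.flatMap aoCl := by
  rw [wOpsRevI, wOpsNat, ← List.map_reverse, List.flatMap_map, List.flatMap_map, List.flatMap_map]
  exact List.flatMap_congr fun op _ => aoOfRt_mapI_cl (S := S) (n := n) op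

/-- The input wires are placed at `0, …, n − 1`. [folklore] -/
theorem map_val_finAddrI_inWires : (inWires S n).map (Fin.val ∘ finAddrI S n) = List.range n := by
  rw [inWires, List.map_map, ← map_val_finRange n]
  rfl

/-- The abstract gates of the input-prefixed queries. [folklore] -/
theorem flatMap_aoOfRt_qOpsI :
    (qOpsI S n).flatMap (fun op => aoOfRt (op.map (finAddrI S n))) = (qIdx S).map (aoQueryI S n) := by
  rw [qOpsI, List.flatMap_map, List.map_eq_flatMap]
  refine List.flatMap_congr fun a _ => ?_
  show [(true, ((qWiresI S n a).map (finAddrI S n)).length,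
      ((qWiresI S n a).map (finAddrI S n) ++ [finAddrI S n (qTgtI S n a)]).map Fin.val)] = [aoQueryI S n a]
  rw [List.length_map, List.map_append, List.map_map, qWiresI, List.length_append, List.map_append,
    map_val_finAddrI_inWires, List.map_map, List.length_map, inWires, List.length_map, List.length_finRange]
  rfl

variable (S n)

/-- **The gates of the compiled input-reading block, abstractly.** [folklore] -/
theorem map_toAO_blockCircI : (blockCircI S n).gates.map toAO = aoBlockI S n := by
  rw [blockCircI, map_toAO_compileList _ (blockOpsNI_isCl S n), blockOpsNI, List.flatMap_map, blockOpsI]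
  simp only [List.flatMap_append]
  rw [flatMap_aoOfRt_wOpsI, flatMap_aoOfRt_qOpsI, flatMap_aoOfRt_wOpsRevI]
  rfl

/-- **The gates of the sandwich circuit, abstractly.** [folklore] -/
theorem map_toAO_sandwichI (σ : Fin (k₁ S) → Bool) :
    (sandwich (blockCircI S n) σ).gates.map toAO = aoCircI S n σ := by
  rw [sandwich]
  simp only [List.map_append]
  rw [map_toAO_hadamardLayer, map_toAO_blockCircI, map_toAO_phaseLayer, map_toAO_yWires_hOn, aoCircI]

/-- **The description of the `n`-th circuit of the input-reading family.** [cite: AroraBarak2009, §6.2] -/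
theorem sigmaEncode_familyI (P : FParams) (n : ℕ) :
    QCircuit.sigmaEncode (G := cliffordT) ⟨n, (familyI P).ancillas n, (familyI P).circ n⟩ =
      pairE natE (pairE unE (rawE aoE))
        (n, (k₁ (spec P n) + k₂ (spec P n)) + mW (spec P n), aoCircI (spec P n) n (famσ P n)) := by
  rw [QCircuit.sigmaEncode_eq]
  show boolPair (encodeNat n) (boolPair (unaryEncodeNat ((k₁ (spec P n) + k₂ (spec P n)) + mW (spec P n)))
    (QCircuit.encode (sandwich (blockCircI (spec P n) n) (famσ P n)))) = _
  rw [encode_eq_rawE_aoE, map_toAO_sandwichI]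
  rfl

end Desc

/-! ### The closed form -/

section Generic

variable (S : BSpec) (n : ℕ) (Lf : ℕ → ℕ) (lvf : ℕ → ℕ) (cpf : ℕ → ℕ → Bool)

/-- The abstract gate of query `(u, j)` in closed form. [folklore] -/
def aoQueryNI (u j : ℕ) : AO :=
  (true, n + ((S.cpre j).length + Lf u),
    (List.range n ++ ((List.range (S.cpre j).length).map (preA S n j) ++
      (List.range (Lf u)).map (sregA S n u (S.K - 1)))) ++ [yregA S n u j])

/-- **The queries in closed form.** [folklore] -/
def queriesNI : List AO := (List.range S.nU).flatMap fun u => (List.range (Lf u)).map (aoQueryNI S n Lf u)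

/-- **The abstract gate list in closed form.** [cite: AroraBarak2009, §6.2] -/
def aoCircNI (σ : ℕ → Bool) : List AO :=
  aoHad n (k₁ S + k₂ S) ++
    ((wOpsN S n Lf lvf cpf).flatMap aoCl ++ queriesNI S n Lf ++ (wOpsN S n Lf lvf cpf).reverse.flatMap aoCl) ++
    aoPhase n (k₁ S + k₂ S) σ ++ aoHad n (k₁ S)

variable {S n Lf lvf cpf}
variable (hL : ∀ u : Fin S.nU, S.L u = Lf u) (hlv : ∀ s : Fin S.K, S.lvl s = lvf s)
  (hcp : ∀ (j : Fin S.Ltop) (p : ℕ), (S.cpre j).getD p false = cpf j p)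

include hL in
/-- One query in closed form. [folklore] -/
theorem aoQueryI_eq (u : Fin S.nU) (j : Fin (S.L u)) : aoQueryI S n ⟨u, j⟩ = aoQueryNI S n Lf u j := by
  rw [aoQueryI, qWires_mk, qTgt_mk, List.map_append, map_natAddr_preWires, map_natAddr_xWires, natAddr_yreg,
    List.length_append, preWires, List.length_map, List.length_finRange, xWires, List.length_map, List.length_finRange,
    aoQueryNI, Fin.val_castLE, ← hL]
  rfl

include hL in
/-- The queries in closed form. [folklore] -/
theorem queriesI_eq : (qIdx S).map (aoQueryI S n) = queriesNI S n Lf := by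
  rw [qIdx, List.map_flatMap, queriesNI, ← flatMap_finRange_val S.nU fun u => (List.range (Lf u)).map (aoQueryNI S n Lf u)]
  refine List.flatMap_congr fun u _ => ?_
  rw [List.map_map, ← hL, ← map_finRange_val (S.L u) (aoQueryNI S n Lf u)]
  exact List.map_congr_left fun j _ => aoQueryI_eq hL u j

include hL hlv hcp in
/-- **The closed form is the abstract gate list**, generically. [cite: AroraBarak2009, §6.2] -/
theorem aoCircI_eqN (σ : Fin (k₁ S) → Bool) : aoCircI S n σ = aoCircNI S n Lf lvf cpf (σNat S σ) := by
  rw [aoCircI, aoBlockI, wOpsNat_eq hL hlv hcp, queriesI_eq hL, aoCircNI]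

/-- The closed form only depends on the block lengths of the units. [folklore] -/
theorem aoCircNI_congr_L {Lf' : ℕ → ℕ} (h : ∀ u < S.nU, Lf u = Lf' u) (σ : ℕ → Bool) :
    aoCircNI S n Lf lvf cpf σ = aoCircNI S n Lf' lvf cpf σ := by
  have hsteps : stepsN S n Lf lvf = stepsN S n Lf' lvf := by
    unfold stepsN
    refine List.flatMap_congr fun m hm => stepN_congr_L S n lvf (h _ ?_) _
    exact Nat.div_lt_of_lt_mul (by rw [Nat.mul_comm]; exact List.mem_range.1 hm)
  have hW : wOpsN S n Lf lvf cpf = wOpsN S n Lf' lvf cpf := by rw [wOpsN, wOpsN, hsteps]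
  have hQ : queriesNI S n Lf = queriesNI S n Lf' := by
    unfold queriesNI
    refine List.flatMap_congr fun u hu => ?_
    have hu' := h u (List.mem_range.1 hu)
    rw [hu']
    refine List.map_congr_left fun j _ => ?_
    simp only [aoQueryNI, hu']
  rw [aoCircNI, aoCircNI, hW, hQ]

end Generic

/-- **The abstract gate list of the `n`-th circuit of the input-reading family in closed form.**
[cite: AroraBarak2009, §6.2] -/
theorem aoCircI_eq (P : FParams) (n : ℕ) :
    aoCircI (spec P n) n (famσ P n) = aoCircNI (spec P n) n (LofN n) (lvlN P n) (cpreBit P n) (σN P n) := by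
  rw [aoCircI_eqN (S := spec P n) (Lf := LofN n) (lvf := lvlN P n) (cpf := cpreBit P n) (spec_L P n) (spec_lvl P n)
    (spec_cpre P n), σNat_eq]

/-! ### The description on codes -/

section Compute

variable (q : Polynomial ℕ)

/-- **One input-prefixed query on codes.** [cite: AroraBarak2009, §6.1] -/
theorem queryI_fp : CodeFP C2E aoE (fun c : (ℕ × ℕ) × ℕ => aoQueryNI (Sq q c.1.1) c.1.1 (LofC q c.1.1) c.1.2 c.2) := by
  have hin : CodeFP C2E (rawE natE) (fun c => List.range c.1.1) := urange.comp c2n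
  have hpre : CodeFP C2E (rawE natE) (fun c => (List.range (cpre (ofPoly q) c.1.1 c.2).length).map
      fun p => preA (Sq q c.1.1) c.1.1 c.2 p) :=
    mapRange (clen_un q c2n c2y) (preA_fp q c3n c3z c3y)
  have hx : CodeFP C2E (rawE natE) (fun c => (List.range (LofC q c.1.1 c.1.2)).map
      fun i => sregA (Sq q c.1.1) c.1.1 c.1.2 (Kn (ofPoly q) c.1.1 - 1) i) :=
    mapRange (LofC_un q c2n c2x) (sregA_fp q c3n c3x (nsub' (size_nat (Kn_un q) c3n) (nconst' _ 1)) c3z)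
  have hy : CodeFP C2E (rawE natE) (fun c => [yregA (Sq q c.1.1) c.1.1 c.1.2 c.2]) :=
    (rawSingleton natE).comp (yregA_fp q c2n c2x c2y)
  have hlen : CodeFP C2E natE (fun c => c.1.1 + ((cpre (ofPoly q) c.1.1 c.2).length + LofC q c.1.1 c.1.2)) :=
    nadd' (natOfUn.comp c2n) (nadd' (natOfUn.comp (clen_un q c2n c2y)) (LofC_nat q c2n c2x))
  exact (ao_mk (const _ true) hlen
    ((rawAppend natE).comp (((rawAppend natE).comp (hin.pair ((rawAppend natE).comp (hpre.pair hx)))).pair hy))).congr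
    fun _ => rfl

/-- **The queries on codes.** [folklore] -/
theorem queriesI_fp : CodeFP unE (rawE aoE) (fun n => queriesNI (Sq q n) n (LofC q n)) :=
  (flatMapRange (nU_un q) (mapRange (LofC_un q c1n c1x) (queryI_fp q))).congr fun _ => rfl

/-- **The abstract gate list of the `n`-th circuit on codes** (capped block lengths). [cite: AroraBarak2009, §6.2] -/
theorem circNI_fp : CodeFP unE (rawE aoE) (fun n =>
    aoCircNI (Sq q n) n (LofC q n) (lvlN (ofPoly q) n) (cpreBit (ofPoly q) n) (σN (ofPoly q) n)) := by
  have hW := (flatMapAoCl_fp).comp (wOps_fp q)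
  have hR := (flatMapAoCl_fp).comp ((rawReverse' clopE).comp (wOps_fp q))
  have happ := rawAppend aoE
  exact (happ.comp ((happ.comp ((happ.comp ((had_fp (uadd' (k₁_un q) (k₂_un q))).pair
    (happ.comp ((happ.comp (hW.pair (queriesI_fp q))).pair hR)))).pair (phase_fp q))).pair (had_fp (k₁_un q)))).congr
    fun _ => rfl

/-- **The description of the input-reading family on codes.** [cite: AroraBarak2009, §6.2] -/
theorem descI_fp : CodeFP unE (pairE natE (pairE unE (rawE aoE))) (fun n =>
    (n, (k₁ (Sq q n) + k₂ (Sq q n)) + mW (Sq q n), aoCircI (Sq q n) n (famσ (ofPoly q) n))) :=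
  (natOfUn.pair ((anc_un q).pair (circNI_fp q))).congr fun n => by
    rw [aoCircI_eq, aoCircNI_congr_L (S := Sq q n) (n := n) (lvf := lvlN (ofPoly q) n) (cpf := cpreBit (ofPoly q) n)
      (fun u hu => (LofC_eq q hu).symm)]
    rfl

/-- **The input-reading quantum core is a polynomial-time uniform family.**
[cite: AroraBarak2009, §6.2 Remark 6.7] [cite: BernsteinVazirani1997, §8] -/
theorem familyI_isUniform : (familyI (ofPoly q)).IsUniform := by
  rw [QCircuitFamily.isUniform_iff_descFn_mem_FP]
  obtain ⟨f, hf, hfe⟩ := descI_fp q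
  have h : (familyI (ofPoly q)).descFn = f ∘ onesFn := funext fun z => by
    rw [Function.comp_apply, QCircuitFamily.descFn, sigmaEncode_familyI, show onesFn z = unE z.length from rfl, hfe]
  rw [h]
  exact comp_mem_FP hf onesFn_mem_FP

end Compute

end PeriodFinding

end Literature.Computability.Cryptography

end
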